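/-
Copyright (c) 2026 the pub-hodgecm-mathlib formalisation cell (harness21).  Prover seat hodgecm-mathlib-F0P2-p01 (g12), programme P2,
ROAD A «ENGINE» of #173 Θ-OCC-GEN — the POSITIVELY ORIENTED half `(mk ι).embedding ∈ Φ_μ`, hypothesis-free, 2026-09-01.
KERNEL module: THEOREMS ONLY (no definition, no named fact, no `sorry`, no instance, no notation).
-/
import Summits.HodgeConjecture.HodgeConjecture.Theorems.F0P2sThetaOccursInOfEngine        -- ★ p844640 ENGINE-GEN (ii): Case A from χN-GEN
import Summits.HodgeConjecture.HodgeConjecture.Theorems.F0P2tChiNGenHolds               -- ★ p844615 (F0P2-p06 (g8) N8): χN-GEN letter-free `chiN_gen`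
import Literature.NumberTheory.Automorphic.UnitaryGroupCohomologicalFormsConjPullback     -- ★ p844763 ARCH-CONJ: `conjU21`, `mem_cohForms_comp_of_conj`
import Summits.HodgeConjecture.HodgeConjecture.Theorems.F0P2aFrameTransport              -- ★ `cmCompactFactor_eq_map_ker_archAt`
import HarnessLib

/-!
# FLOOR-0 P2 · ROAD A of #173 Θ-OCC-GEN — `StubThetaOccursInGen` at every CM frame whose place is POSITIVELY ORIENTED for `μ`
# (`(mk ι).embedding ∈ Φ_μ`), hypothesis-free: Case A `(mk ι).embedding = ι` by the engine, Case D `(mk ι).embedding = conj ∘ ι` by the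
# engine at the re-oriented frame `((mk ι).embedding, T̄)` and the antiholomorphic pull-back ★ `mem_cohForms_comp_of_conj` along `id`

Cell hodgecm-mathlib (D-0151), FLOOR 0; crux item H413 = stmt-HodgeConjecture-24833 (route `HCCMUnconditional`, no route verbs); programme P2, the
OCC♭-GEN line `Cruxes/H413/Lines/F0_P2OccFlatGeneral.lean` (ED. 2, FROZEN by director s896 (α)), its one letter Θ-OCC-GEN
`stub_thetaOccursInGen : StubThetaOccursInGen` (books #173, UNPROVED L; carrier from E1 ED. 3 on: `Cruxes/H413/Lines/F0_P2E3RelSign.lean` §1).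
THEOREMS ONLY; `--supports stmt-HodgeConjecture-24833`.  Desk PLAN-P2 v14 §1 ROAD A; this prover's ROAD A CENSUS (cell bus 2026-09-01T13:5xZ).

* §1 frame re-orientation at the canonical representative `ι₀ := (mk ι).embedding` of the place of `ι` when `ι₀ ≠ ι` (so `ι₀ = conj ∘ ι`,
  ★ `embedding_mk_eq_conjugate_of_ne`): `H^{ι₀} = \overline{H^ι}`, so `T̄ := GL₃(conj) T` is a frame at `ι₀` (`conjTranspose_conjFrame_mul`), `H` stays definite
  off the (same) place, and **`cmArchSection_eq_conjU21`**: `cmArchSection L ι H T u = cmArchSection L ι₀ H T̄ (conjU21 u)` for every `u ∈ U(2,1)` — both are the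
  archimedean element concentrated at the place of `ι` whose `σ_{w}`-coordinate is `T̄ ū T̄⁻¹` (the un-twist ★ `embTwist ι = conj`, `embTwist ι₀ = id`);
  `cmCompactFactor` is the same for the two frames (`cmCompactFactor_eq_of_embedding`, ★ `cmCompactFactor_eq_map_ker_archAt`).
* §2 **`thetaOccursInGen_caseA`** — the BODY of `StubThetaOccursInGen` (`F0_P2OccFlatGeneral.lean` :152–188) under the two orientation hypotheses
  `(mk ι).embedding = ι`, `ι ∈ hμ.cmType.1`, hypothesis-free otherwise: ★ `F0P2sThetaOccursInOfEngine.thetaOccursInGen_caseA_of_chiN` fed with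
  F0P2-p06 (g8)'s ★ `F0P2tChiNGenHolds.chiN_gen` (`h4 ⟸ hV`: `[F:ℚ] = 2[F⁺:ℚ] ≠ 2`; `Φ := hμ.cmType`; `hmem := hemb ▸ hι`).
* §3 **`thetaOccursInGen_caseD`** — the body under `(mk ι).embedding ≠ ι`, `(mk ι).embedding ∈ hμ.cmType.1`: Case A at the re-oriented frame
  `((mk ι).embedding, T̄)` (§1) gives `θ` valued in `cohForms (cmArchSection L ι₀ H T̄) (cmCompactFactor …)`; ★ `mem_cohForms_comp_of_conj` along
  `κ := id` with `cmArchSection L ι H T = cmArchSection L ι₀ H T̄ ∘ conjU21` (§1) carries its values into `cohForms (cmArchSection L ι H T) (cmCompactFactor …)`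
  (holomorphic at `(ι₀, T̄)` = antiholomorphic at `(ι, T)`); `θ` itself is unchanged, so non-vanishing and `ρ(a,χ)`-equivariance are kept verbatim.
* §4 **`thetaOccursInGen_of_embedding_mem`** — the body of `StubThetaOccursInGen` under the SINGLE extra hypothesis `(mk ι).embedding ∈ hμ.cmType.1`
  («the place of `ι` is positively oriented for `μ` in Mathlib's canonical coordinates»): Case A or Case D.

WHAT IS LEFT OF #173 after this file: the NEGATIVELY oriented half `(mk ι).embedding ∉ hμ.cmType.1` (the theta lift is antiholomorphic in the
canonical coordinates of the place; [Liu2021, Lem. D.2 (2)]), to be reached by the CONJ-TWIST over COR-CM's ★ RSCONJ θ-twist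
(`RecordSystemConjOmegaTwistCarriers.omegaConjEquiv` ∕ `…_rhoVAtLine`, `RecordSystemConjOmegaLabel.conjFamily_sChiD_toHeckeCharacter`) + §4 at the
conjugate hermitian space `c̄(H)` for `(μᶜ, −a′, χ⁻¹)` + ★ `mem_cohForms_comp(_of_conj)` along `c̄ ⊗ 1 : U(H)(𝔸) → U(c̄H)(𝔸)`.  Nothing of print is asserted
here; HC_CM is proved only modulo the printed citations until rung 0 closes.

## References
* [Liu2021] Y. Liu, *Fourier–Jacobi cycles and arithmetic relative trace formula*, Camb. J. Math. 9 (2021) = arXiv:2102.11518: Prop. 4.13 («Conversely»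
  l. 2145–2149); Def. 4.11–4.12; App. D §D.1 Steps 1–3, Lem. D.1–D.2.
* [GelbartRogawski1991] S. Gelbart, J. Rogawski, Invent. Math. 105 (1991), §3.1 Prop. 3.1.1 p. 455; Remark p. 457 L4–13.
* [Li1992] J.-S. Li, J. reine angew. Math. 428 (1992), Thm 2.1 (26)–(27) p. 184.  [KonnoKonno2007] T. Konno, K. Konno, Kyushu J. Math. 61 (2007), Thm 5.4.
* [BorelJacquet1979] §4.1 (the archimedean factor `G(F_v) ↪ G(𝔸)`); [BorelWallach2000] VII 2.10; [PlatonovRapinchuk1994] §2.3, §5.1.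
-/

set_option autoImplicit false

-- the mandated namespace has the single-problem summit's repeated segment (`HodgeConjecture.HodgeConjecture`)
set_option linter.dupNamespace false

noncomputable section

open MulAction NumberField NumberField.InfinitePlace NumberField.mixedEmbedding IsDedekindDomain
open scoped SchwartzMap TensorProduct Classical Matrix ComplexOrder
open Literature.NumberTheory.Automorphic Literature.NumberTheory.Automorphic.UnitaryGroup Literature.NumberTheory.Weil1964
open Literature.NumberTheory.Automorphic.UnitaryGroup.CotangentForms
open Literature.NumberTheory.Automorphic.IdeleClassGroup
open Literature.Geometry.ComplexHyperbolic.BallModel (U21 x₀)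
open Literature.AlgebraicGeometry.ShimuraVarieties
open Literature.AlgebraicGeometry.Motives (CMType)
open Literature.NumberTheory.GelbartRogawski1991 Literature.NumberTheory.GelbartRogawski1991.UnitaryDualPair
open Literature.NumberTheory.GelbartRogawski1991.UnitaryDualPair.WeilCoinv (commute_comp_inl_comp_inr finPairToAdelic finPairRep)
open Literature.NumberTheory.Automorphic.Liu2021
open Literature.NumberTheory.Automorphic.Liu2021.Def411WeilCarriers
open Literature.NumberTheory.Automorphic.Liu2021.Def411WeilCarriersDoubling
open Literature.NumberTheory.GaloisRepresentations (HeckeCharacter)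
open Literature.RepresentationTheory Literature.RepresentationTheory.Liu2021
open Literature.RepresentationTheory.HarrisKudlaSweet1996 (IsSplittingChar)
open HodgeCM HodgeCM.Adelic HodgeCM.PerL34 HodgeCM.Model HodgeCM.Model.ThetaSpace HodgeCM.Model.ArchSideTerm HodgeCM.Model.ThetaAdelicSide
open HodgeCM.Model.ThetaDistFin HodgeCM.Model.HypCensus HodgeCM.Model.LiuIndex HodgeCM.Model.TowerCarrier
open HodgeCM.Model.SupplyResidual.WeilPairData (charInv)
open Literature.Analysis.SegalBargmann (binvPi)
open Literature.AlgebraicGeometry.ShimuraVarieties (BallForms.isPullbackCocycle_cotangentCocycle BallForms.expP)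
open Literature.AlgebraicGeometry.Liu2021 (IsAdmissibleElement)
open Summit.HodgeConjecture.CorCM Summit.HodgeConjecture.CorCM.Model Summit.HodgeConjecture.CorCM.Transposition
open Summit.HodgeConjecture.CorCM.Transposition.OmegaChiSplitting (hsChiD)
open Summit.HodgeConjecture.HodgeConjecture.Cruxes.H413
open Summit.HodgeConjecture.HodgeConjecture.Cruxes.H413.ThetaJunction
open Summit.HodgeConjecture.HodgeConjecture.Cruxes.H413.CohFormsCarriers
open Summit.HodgeConjecture.HodgeConjecture.Cruxes.H413.CuspCot
open Summit.HodgeConjecture.HodgeConjecture.Cruxes.H413.ThetaDistAtLine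
open Summit.HodgeConjecture.HodgeConjecture.Cruxes.H413.AdmissibleLine
open Summit.HodgeConjecture.HodgeConjecture.Cruxes.H413.F0P2OccGenCotangentOfOccursIn (cmFieldOf hermSpace3Of)
open Summit.HodgeConjecture.HodgeConjecture.Cruxes.H413.F0P3HolProjectionReduction (four_le_finrank_of_two_le)

open Literature.NumberTheory.Automorphic.UnitaryGroup.CotangentForms
open Literature.Geometry.ComplexHyperbolic
open Literature.Geometry.ComplexHyperbolic.BallModel (U21 x₀ conjU21 mat)
open NumberField.InfinitePlace

namespace Summit.HodgeConjecture.HodgeConjecture.Cruxes.H413.F0P2sThetaOccursInGenOriented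

/-! ## §1 Re-orientation of a CM frame at the canonical representative of its place -/

section Frame

variable (L : Type) [Field L] [NumberField L] [IsCMField L] (ι : L →+* ℂ) (H : Matrix (Fin 3) (Fin 3) L) (T : GL (Fin 3) ℂ)
  (hT : (T : Matrix (Fin 3) (Fin 3) ℂ)ᴴ * H.map ι * (T : Matrix (Fin 3) (Fin 3) ℂ) = Literature.Geometry.ComplexHyperbolic.BallModel.J)

/-- `J = diag(1,1,−1)` is real. [folklore] -/
private theorem J_map_conj' : Literature.Geometry.ComplexHyperbolic.BallModel.J.map (starRingEnd ℂ) = Literature.Geometry.ComplexHyperbolic.BallModel.J := by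
  rw [Literature.Geometry.ComplexHyperbolic.BallModel.J, Matrix.diagonal_map (map_zero _)]
  congr 1
  funext i
  fin_cases i <;> simp

omit [NumberField L] [IsCMField L] in
/-- `H^{σ_w} = \overline{H^ι}` when Mathlib's representative `σ_w = (mk ι).embedding` of the place of `ι` is not `ι` (then it is `conj ∘ ι`).
[cite: PlatonovRapinchuk1994, §2.3] -/
theorem map_embedding_eq_map_map_conj (hne : (InfinitePlace.mk ι).embedding ≠ ι) :
    H.map (InfinitePlace.mk ι).embedding = (H.map ι).map (starRingEnd ℂ) := by
  rw [UnitaryGroup.embedding_mk_eq_conjugate_of_ne L ι hne, Matrix.map_map]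
  exact congrArg H.map (funext fun x => ComplexEmbedding.conjugate_coe_eq ι x)

omit [NumberField L] [IsCMField L] in
include hT in
/-- **the conjugate frame `T̄ = GL₃(conj) T` is a frame of `H` at the canonical representative `(mk ι).embedding` when that is `conj ∘ ι`**:
`T̄ᴴ H^{conj ι} T̄ = \overline{Tᴴ H^ι T} = J̄ = J`. [cite: PlatonovRapinchuk1994, §2.3] [cite: BergeronMillsonMoeglin2016Balls, Part 2 §1.1] -/
theorem conjTranspose_conjFrame_mul (hne : (InfinitePlace.mk ι).embedding ≠ ι) :
    ((Matrix.GeneralLinearGroup.map (starRingEnd ℂ) T : GL (Fin 3) ℂ) : Matrix (Fin 3) (Fin 3) ℂ)ᴴ * H.map (InfinitePlace.mk ι).embedding *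
        ((Matrix.GeneralLinearGroup.map (starRingEnd ℂ) T : GL (Fin 3) ℂ) : Matrix (Fin 3) (Fin 3) ℂ) = Literature.Geometry.ComplexHyperbolic.BallModel.J := by
  rw [map_embedding_eq_map_map_conj L ι H hne]
  have hc : ((Matrix.GeneralLinearGroup.map (starRingEnd ℂ) T : GL (Fin 3) ℂ) : Matrix (Fin 3) (Fin 3) ℂ) = (T : Matrix (Fin 3) (Fin 3) ℂ).map (starRingEnd ℂ) := rfl
  have h := congrArg (fun M : Matrix (Fin 3) (Fin 3) ℂ => M.map (starRingEnd ℂ)) hT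
  simp only [Matrix.map_mul, J_map_conj'] at h
  rw [hc, ← Matrix.conjTranspose_map (starRingEnd ℂ) (fun z => by simp)]
  exact h

omit [NumberField L] [IsCMField L] in
/-- `H` stays positive definite off the place of `ι` when the frame embedding is replaced by `(mk ι).embedding` (same place).
[cite: PlatonovRapinchuk1994, §3.2 Thm 3.1] -/
theorem posDef_off_embedding (hpos : ∀ τ' : L →+* ℂ, InfinitePlace.mk τ' ≠ InfinitePlace.mk ι → (H.map τ').PosDef) :
    ∀ τ' : L →+* ℂ, InfinitePlace.mk τ' ≠ InfinitePlace.mk (InfinitePlace.mk ι).embedding → (H.map τ').PosDef := fun τ' h =>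
  hpos τ' (by rwa [InfinitePlace.mk_embedding] at h)

/-- dependent `Pi.mulSingle` at propositionally equal indices with equal underlying group elements. [folklore] -/
private theorem mulSingle_eq_of_coe_eq {I : Type*} [DecidableEq I] {G : Type*} [Group G] (A : I → Subgroup G) {i j : I} (h : i = j)
    (x : A i) (y : A j) (hxy : (x : G) = (y : G)) : Pi.mulSingle (M := fun k => ↥(A k)) i x = Pi.mulSingle j y := by
  subst h
  rw [Subtype.ext hxy]

/-- **the section through `(ι, T)` IS the section through `((mk ι).embedding, T̄)` precomposed with `u ↦ ū`** when `(mk ι).embedding ≠ ι`: both are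
the archimedean element of `U(H)(𝔸)` concentrated at the place of `ι` with `σ_w`-coordinate `T̄ ū T̄⁻¹ = \overline{T u T⁻¹}` (★ `embTwist ι = conj`,
`embTwist (mk ι).embedding = id`). [cite: BorelJacquet1979, §4.1] [cite: PlatonovRapinchuk1994, §2.3] -/
theorem cmArchSection_eq_conjU21 (hne : (InfinitePlace.mk ι).embedding ≠ ι)
    (hT₀ : ((Matrix.GeneralLinearGroup.map (starRingEnd ℂ) T : GL (Fin 3) ℂ) : Matrix (Fin 3) (Fin 3) ℂ)ᴴ * H.map (InfinitePlace.mk ι).embedding *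
        ((Matrix.GeneralLinearGroup.map (starRingEnd ℂ) T : GL (Fin 3) ℂ) : Matrix (Fin 3) (Fin 3) ℂ) = Literature.Geometry.ComplexHyperbolic.BallModel.J)
    (u : U21) :
    cmArchSection L ι H T hT u = cmArchSection L (InfinitePlace.mk ι).embedding H (Matrix.GeneralLinearGroup.map (starRingEnd ℂ) T) hT₀ (conjU21 u) := by
  classical
  have hemb₀ : (InfinitePlace.mk (InfinitePlace.mk ι).embedding).embedding = (InfinitePlace.mk ι).embedding := by rw [InfinitePlace.mk_embedding]
  have hplace : UnitaryGroup.cmPlace L ι = UnitaryGroup.cmPlace L (InfinitePlace.mk ι).embedding :=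
    Subtype.ext (InfinitePlace.mk_embedding (InfinitePlace.mk ι)).symm
  rw [cmArchSection_eq, cmArchSection_eq]
  unfold UnitaryGroup.archSectionU21CM
  rw [UnitaryGroup.archSectionU21Emb_apply, UnitaryGroup.archSectionU21Emb_apply, UnitaryGroup.adelicSingle_apply, UnitaryGroup.adelicSingle_apply,
    UnitaryGroup.archSingle_apply, UnitaryGroup.archSingle_apply]
  congr 2
  refine mulSingle_eq_of_coe_eq (fun w => UnitaryGroup.archLocal L 3 H w) hplace _ _ ?_
  rw [UnitaryGroup.coe_archLocalOfEmb, UnitaryGroup.coe_archLocalOfEmb, UnitaryGroup.coe_formEquivU21_symm_apply,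
    UnitaryGroup.coe_formEquivU21_symm_apply]
  have h1 : UnitaryGroup.embTwist L ι = starRingEnd ℂ := by rw [UnitaryGroup.embTwist, if_neg hne]
  have h2 : UnitaryGroup.embTwist L (InfinitePlace.mk ι).embedding = RingHom.id ℂ := by rw [UnitaryGroup.embTwist, if_pos hemb₀]
  rw [h1, h2, Matrix.GeneralLinearGroup.map_id, MonoidHom.id_apply, map_mul, map_mul, map_inv]
  rfl

/-- the compact archimedean factor does not see the frame embedding (it is `archToAdelic (ker archAt v(ι))`, and `v((mk ι).embedding) = v(ι)`).
[cite: BorelJacquet1979, §4.1] -/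
theorem cmCompactFactor_eq_of_embedding (T₀ : GL (Fin 3) ℂ)
    (hT₀ : (T₀ : Matrix (Fin 3) (Fin 3) ℂ)ᴴ * H.map (InfinitePlace.mk ι).embedding * (T₀ : Matrix (Fin 3) (Fin 3) ℂ) = Literature.Geometry.ComplexHyperbolic.BallModel.J) :
    cmCompactFactor L ι H T hT = cmCompactFactor L (InfinitePlace.mk ι).embedding H T₀ hT₀ := by
  have hplace : UnitaryGroup.cmPlace L (InfinitePlace.mk ι).embedding = UnitaryGroup.cmPlace L ι :=
    Subtype.ext (InfinitePlace.mk_embedding (InfinitePlace.mk ι))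
  rw [F0P2aFrameTransport.cmCompactFactor_eq_map_ker_archAt, F0P2aFrameTransport.cmCompactFactor_eq_map_ker_archAt, hplace]

end Frame

/-! ## §2 Case A: `(mk ι).embedding = ι ∈ Φ_μ` — ENGINE-GEN ★ p844640 ∘ χN-GEN ★ p844615 -/

set_option synthInstance.maxHeartbeats 400000 in
set_option maxHeartbeats 8000000 in
/-- **Θ-OCC-GEN, CASE A (`(mk ι).embedding = ι ∈ Φ_μ`), hypothesis-free**: the body of `StubThetaOccursInGen` under the two orientation hypotheses.
ENGINE-GEN ★ p844640 ∘ χN-GEN ★ p844615 (`h4 ⟸ hV`, `Φ := hμ.cmType`, `hmem := hemb ▸ hι`).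
[cite: Liu2021, Prop. 4.13 («Conversely» l. 2145–2149); Def. 4.11–4.12; App. D §D.1 Steps 1–3, Lem. D.2] [cite: GelbartRogawski1991, §3.1 Prop. 3.1.1 p. 455; Remark p. 457 L4–13]
[cite: Li1992, Thm 2.1 (26) p. 184] [cite: KonnoKonno2007, Thm 5.4] -/
theorem thetaOccursInGen_caseA :
  ∀ (L : Type) [Field L] [NumberField L] [IsCMField L] (ι : L →+* ℂ) (H : Matrix (Fin 3) (Fin 3) L) (T : GL (Fin 3) ℂ)
    (hT : (T : Matrix (Fin 3) (Fin 3) ℂ)ᴴ * H.map ι * (T : Matrix (Fin 3) (Fin 3) ℂ) = Literature.Geometry.ComplexHyperbolic.BallModel.J),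
    (∀ τ' : L →+* ℂ, InfinitePlace.mk τ' ≠ InfinitePlace.mk ι → (H.map τ').PosDef) → 2 ≤ Module.finrank ℚ ↥(maximalRealSubfield L) →
    ∀ {n' : ℕ} (e₁ : Fin 3 × Fin 1 ≃ Fin n') (dV : Fin 3 → L) (hdV : ∀ i, IsCMField.complexConj L (dV i) = dV i)
      (hdV0 : ∀ i, dV i ≠ 0) (g : GL (Fin 3) L)
      (hg : ((g : Matrix (Fin 3) (Fin 3) L).map (cmConjRingHom L))ᵀ * H * (g : Matrix (Fin 3) (Fin 3) L) = Matrix.diagonal dV)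
      (ιV : finAdelic (↥(maximalRealSubfield L)) L (IsCMField.complexConj L) 3 H →*
          finAdelic (↥(maximalRealSubfield L)) L (IsCMField.complexConj L) 3 (Matrix.diagonal dV)),
        (∀ k, ((ιV k : finAdelic (↥(maximalRealSubfield L)) L (IsCMField.complexConj L) 3 (Matrix.diagonal dV)) :
            GL (Fin 3) (FiniteAdeleRing (𝓞 L) L)) =
          (toFinAdeleGL L 3 g)⁻¹ * (k : GL (Fin 3) (FiniteAdeleRing (𝓞 L) L)) * toFinAdeleGL L 3 g) →
        ∀ (μ : Literature.NumberTheory.Automorphic.IdeleClassGroup L →ₜ* Circle) (hμ : IsConjugateSymplectic L μ), HasWeight L μ 1 →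
          ∀ (a : (↥(maximalRealSubfield L))ˣ) (χ : Chi (↥(maximalRealSubfield L)) L (IsCMField.complexConj L)),
            (∃ e : L, IsAdmissibleElement L hμ.cmType.1 e ∧
                epsOf (↥(maximalRealSubfield L)) (imagUnitSq L) L (2 * imagUnit L)⁻¹ e = locF (↥(maximalRealSubfield L)) (imagUnitSq L) a) →
              (InfinitePlace.mk ι).embedding = ι → ι ∈ hμ.cmType.1 →
              ∃ θ : (omegaAtLine (↥(maximalRealSubfield L)) L (IsCMField.complexConj L) 3 e₁ (Matrix.diagonal dV)
                      (complexConj_imagUnit L) (imagUnit_ne_zero L) (imagUnit_mul_self L) (realDiagonal_isSymm L dV hdV)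
                      (isUnit_det_realDiagonal L dV hdV hdV0) (realDiagonal_map L dV hdV).symm
                      (fun a => isCompatible_chiSplittingLine L e₁ dV hdV hdV0 (toHeckeCharacter L μ)
                        (isUnitary_toHeckeCharacter L μ) ((isOscillatorChar_toHeckeCharacter_iff μ).mpr hμ)
                        (TW (↥(maximalRealSubfield L)) a) (isSymm_TW (↥(maximalRealSubfield L)) a)
                        (isUnit_det_TW (↥(maximalRealSubfield L)) a) (JW (↥(maximalRealSubfield L)) L a)
                        (JW_eq (↥(maximalRealSubfield L)) L a)) a χ) →ₗ[ℂ]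
                    ((adelicGroupData (↥(maximalRealSubfield L)) L (IsCMField.complexConj L) 3 H).Adelic → (Fin 2 → ℂ)),
                θ ≠ 0 ∧
                (∀ w, θ w ∈ CotangentForms.cohForms (↥(maximalRealSubfield L)) L (IsCMField.complexConj L) 3 H
                    (cmArchSection L ι H T hT) (cmCompactFactor L ι H T hT)) ∧
                ∀ (k : ↥(finAdelic (↥(maximalRealSubfield L)) L (IsCMField.complexConj L) 3 H)) w,
                  θ (rhoAtLine (↥(maximalRealSubfield L)) L (IsCMField.complexConj L) 3 e₁ (Matrix.diagonal dV)
                      (complexConj_imagUnit L) (imagUnit_ne_zero L) (imagUnit_mul_self L) (realDiagonal_isSymm L dV hdV)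
                      (isUnit_det_realDiagonal L dV hdV hdV0) (realDiagonal_map L dV hdV).symm
                      (fun a => isCompatible_chiSplittingLine L e₁ dV hdV hdV0 (toHeckeCharacter L μ)
                        (isUnitary_toHeckeCharacter L μ) ((isOscillatorChar_toHeckeCharacter_iff μ).mpr hμ)
                        (TW (↥(maximalRealSubfield L)) a) (isSymm_TW (↥(maximalRealSubfield L)) a)
                        (isUnit_det_TW (↥(maximalRealSubfield L)) a) (JW (↥(maximalRealSubfield L)) L a)
                        (JW_eq (↥(maximalRealSubfield L)) L a)) ιV a χ k w) =
                    fun x => θ w (x * finAdelicToAdelic (↥(maximalRealSubfield L)) L (IsCMField.complexConj L) 3 H k)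
 :=
  F0P2sThetaOccursInOfEngine.thetaOccursInGen_caseA_of_chiN fun F _ι₁ V hV hemb μ hμ hw hι χ e a he hae =>
    F0P2tChiNGenHolds.chiN_gen F V
      (by
        -- `[F:ℚ] = 2 [F⁺:ℚ]`, `[F⁺:ℚ] ≥ 1`, and anisotropy gives `[F:ℚ] ≠ 2`
        have hne : Module.finrank ℚ (F : Type) ≠ 2 := (HodgeCM.HermSpace3.isAnisotropic_iff_finrank_ne_two V).1 hV
        have hmul := Module.finrank_mul_finrank ℚ ↥(maximalRealSubfield (F : Type)) (F : Type)
        rw [Algebra.IsQuadraticExtension.finrank_eq_two ↥(maximalRealSubfield (F : Type)) (F : Type)] at hmul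
        have hpos : 0 < Module.finrank ℚ ↥(maximalRealSubfield (F : Type)) := Module.finrank_pos
        omega)
      hμ.cmType μ hμ hw (by rw [hemb]; exact hι) χ e a he hae

/-! ## §3 Case D: `(mk ι).embedding ≠ ι`, `(mk ι).embedding ∈ Φ_μ` — Case A at the re-oriented frame + antiholomorphic pull-back along `id` -/

set_option synthInstance.maxHeartbeats 400000 in
set_option maxHeartbeats 8000000 in
/-- **Θ-OCC-GEN, CASE D (`ι₀ := (mk ι).embedding ≠ ι`, `ι₀ ∈ Φ_μ`), hypothesis-free**: Case A at `(ι₀, T̄)` (§1: `T̄` is a frame at `ι₀`, `(mk ι₀).embedding = ι₀`,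
`H` definite off the place) yields `θ` valued in `cohForms (cmArchSection L ι₀ H T̄) (cmCompactFactor …)`; since `cmArchSection L ι H T = cmArchSection L ι₀ H T̄ ∘ conjU21`
(§1) and the compact factors agree, ★ `mem_cohForms_comp_of_conj` along `κ := id` puts every value in `cohForms (cmArchSection L ι H T) (cmCompactFactor …)`;
`θ` is unchanged.  [cite: Liu2021, Prop. 4.13 («Conversely» l. 2145–2149); App. D Lem. D.2 (2)] [cite: BorelWallach2000, VII 2.10] [cite: BorelJacquet1979, §4.1] -/
theorem thetaOccursInGen_caseD :
  ∀ (L : Type) [Field L] [NumberField L] [IsCMField L] (ι : L →+* ℂ) (H : Matrix (Fin 3) (Fin 3) L) (T : GL (Fin 3) ℂ)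
    (hT : (T : Matrix (Fin 3) (Fin 3) ℂ)ᴴ * H.map ι * (T : Matrix (Fin 3) (Fin 3) ℂ) = Literature.Geometry.ComplexHyperbolic.BallModel.J),
    (∀ τ' : L →+* ℂ, InfinitePlace.mk τ' ≠ InfinitePlace.mk ι → (H.map τ').PosDef) → 2 ≤ Module.finrank ℚ ↥(maximalRealSubfield L) →
    ∀ {n' : ℕ} (e₁ : Fin 3 × Fin 1 ≃ Fin n') (dV : Fin 3 → L) (hdV : ∀ i, IsCMField.complexConj L (dV i) = dV i)
      (hdV0 : ∀ i, dV i ≠ 0) (g : GL (Fin 3) L)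
      (hg : ((g : Matrix (Fin 3) (Fin 3) L).map (cmConjRingHom L))ᵀ * H * (g : Matrix (Fin 3) (Fin 3) L) = Matrix.diagonal dV)
      (ιV : finAdelic (↥(maximalRealSubfield L)) L (IsCMField.complexConj L) 3 H →*
          finAdelic (↥(maximalRealSubfield L)) L (IsCMField.complexConj L) 3 (Matrix.diagonal dV)),
        (∀ k, ((ιV k : finAdelic (↥(maximalRealSubfield L)) L (IsCMField.complexConj L) 3 (Matrix.diagonal dV)) :
            GL (Fin 3) (FiniteAdeleRing (𝓞 L) L)) =
          (toFinAdeleGL L 3 g)⁻¹ * (k : GL (Fin 3) (FiniteAdeleRing (𝓞 L) L)) * toFinAdeleGL L 3 g) →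
        ∀ (μ : Literature.NumberTheory.Automorphic.IdeleClassGroup L →ₜ* Circle) (hμ : IsConjugateSymplectic L μ), HasWeight L μ 1 →
          ∀ (a : (↥(maximalRealSubfield L))ˣ) (χ : Chi (↥(maximalRealSubfield L)) L (IsCMField.complexConj L)),
            (∃ e : L, IsAdmissibleElement L hμ.cmType.1 e ∧
                epsOf (↥(maximalRealSubfield L)) (imagUnitSq L) L (2 * imagUnit L)⁻¹ e = locF (↥(maximalRealSubfield L)) (imagUnitSq L) a) →
              (InfinitePlace.mk ι).embedding ≠ ι → (InfinitePlace.mk ι).embedding ∈ hμ.cmType.1 →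
              ∃ θ : (omegaAtLine (↥(maximalRealSubfield L)) L (IsCMField.complexConj L) 3 e₁ (Matrix.diagonal dV)
                      (complexConj_imagUnit L) (imagUnit_ne_zero L) (imagUnit_mul_self L) (realDiagonal_isSymm L dV hdV)
                      (isUnit_det_realDiagonal L dV hdV hdV0) (realDiagonal_map L dV hdV).symm
                      (fun a => isCompatible_chiSplittingLine L e₁ dV hdV hdV0 (toHeckeCharacter L μ)
                        (isUnitary_toHeckeCharacter L μ) ((isOscillatorChar_toHeckeCharacter_iff μ).mpr hμ)
                        (TW (↥(maximalRealSubfield L)) a) (isSymm_TW (↥(maximalRealSubfield L)) a)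
                        (isUnit_det_TW (↥(maximalRealSubfield L)) a) (JW (↥(maximalRealSubfield L)) L a)
                        (JW_eq (↥(maximalRealSubfield L)) L a)) a χ) →ₗ[ℂ]
                    ((adelicGroupData (↥(maximalRealSubfield L)) L (IsCMField.complexConj L) 3 H).Adelic → (Fin 2 → ℂ)),
                θ ≠ 0 ∧
                (∀ w, θ w ∈ CotangentForms.cohForms (↥(maximalRealSubfield L)) L (IsCMField.complexConj L) 3 H
                    (cmArchSection L ι H T hT) (cmCompactFactor L ι H T hT)) ∧
                ∀ (k : ↥(finAdelic (↥(maximalRealSubfield L)) L (IsCMField.complexConj L) 3 H)) w,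
                  θ (rhoAtLine (↥(maximalRealSubfield L)) L (IsCMField.complexConj L) 3 e₁ (Matrix.diagonal dV)
                      (complexConj_imagUnit L) (imagUnit_ne_zero L) (imagUnit_mul_self L) (realDiagonal_isSymm L dV hdV)
                      (isUnit_det_realDiagonal L dV hdV hdV0) (realDiagonal_map L dV hdV).symm
                      (fun a => isCompatible_chiSplittingLine L e₁ dV hdV hdV0 (toHeckeCharacter L μ)
                        (isUnitary_toHeckeCharacter L μ) ((isOscillatorChar_toHeckeCharacter_iff μ).mpr hμ)
                        (TW (↥(maximalRealSubfield L)) a) (isSymm_TW (↥(maximalRealSubfield L)) a)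
                        (isUnit_det_TW (↥(maximalRealSubfield L)) a) (JW (↥(maximalRealSubfield L)) L a)
                        (JW_eq (↥(maximalRealSubfield L)) L a)) ιV a χ k w) =
                    fun x => θ w (x * finAdelicToAdelic (↥(maximalRealSubfield L)) L (IsCMField.complexConj L) 3 H k)
 := by
  intro L _ _ _ ι H T hT hHpos h2 n' eV dV hdV hdV0 g hg ιV hιV μ hμ hw a χ hadm hne hmem
  -- the re-oriented frame `(ι₀, T̄)` at the canonical representative `ι₀ := (mk ι).embedding`
  have hT₀ := conjTranspose_conjFrame_mul L ι H T hT hne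
  have hemb₀ : (InfinitePlace.mk (InfinitePlace.mk ι).embedding).embedding = (InfinitePlace.mk ι).embedding := by rw [InfinitePlace.mk_embedding]
  obtain ⟨θ, hθ0, hθA, hθσ⟩ := thetaOccursInGen_caseA L (InfinitePlace.mk ι).embedding H (Matrix.GeneralLinearGroup.map (starRingEnd ℂ) T) hT₀
    (posDef_off_embedding L ι H hHpos) h2 eV dV hdV hdV0 g hg ιV hιV μ hμ hw a χ hadm hemb₀ hmem
  refine ⟨θ, hθ0, fun w => ?_, hθσ⟩
  -- values: `cohForms (ι₀, T̄) ∋ θ w = (θ w) ∘ id ∈ cohForms (ι, T)` by the antiholomorphic pull-back along `id`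
  have hrel : ∀ u : U21, (MonoidHom.id (adelicGroupData (↥(maximalRealSubfield L)) L (IsCMField.complexConj L) 3 H).Adelic) (cmArchSection L ι H T hT u) =
      cmArchSection L (InfinitePlace.mk ι).embedding H (Matrix.GeneralLinearGroup.map (starRingEnd ℂ) T) hT₀ (conjU21 u) := fun u => by
    rw [MonoidHom.id_apply]; exact cmArchSection_eq_conjU21 L ι H T hT hne hT₀ u
  have hK : ∀ k ∈ cmCompactFactor L ι H T hT, (MonoidHom.id _) k ∈ cmCompactFactor L (InfinitePlace.mk ι).embedding H (Matrix.GeneralLinearGroup.map (starRingEnd ℂ) T) hT₀ :=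
    fun k hk => by rw [MonoidHom.id_apply, ← cmCompactFactor_eq_of_embedding L ι H T hT _ hT₀]; exact hk
  exact mem_cohForms_comp_of_conj (κ := MonoidHom.id _) (κf := MonoidHom.id _) hrel (fun γ hγ => hγ) hK (fun g => rfl) continuous_id (hθA w)

/-! ## §4 The positively oriented half of Θ-OCC-GEN -/

set_option synthInstance.maxHeartbeats 400000 in
set_option maxHeartbeats 8000000 in
/-- **Θ-OCC-GEN WHENEVER THE PLACE OF `ι` IS POSITIVELY ORIENTED FOR `μ`** — the body of `StubThetaOccursInGen` (`F0_P2OccFlatGeneral.lean` :152–188) under the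
single extra hypothesis `(InfinitePlace.mk ι).embedding ∈ hμ.cmType.1`, hypothesis-free otherwise (Case A if `(mk ι).embedding = ι`, Case D if not).
[cite: Liu2021, Prop. 4.13 («Conversely» l. 2145–2149); Def. 4.11–4.12; App. D §D.1 Steps 1–3, Lem. D.2] [cite: GelbartRogawski1991, §3.1 Prop. 3.1.1 p. 455; Remark p. 457 L4–13]
[cite: Li1992, Thm 2.1 (26) p. 184] [cite: KonnoKonno2007, Thm 5.4] -/
theorem thetaOccursInGen_of_embedding_mem :
  ∀ (L : Type) [Field L] [NumberField L] [IsCMField L] (ι : L →+* ℂ) (H : Matrix (Fin 3) (Fin 3) L) (T : GL (Fin 3) ℂ)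
    (hT : (T : Matrix (Fin 3) (Fin 3) ℂ)ᴴ * H.map ι * (T : Matrix (Fin 3) (Fin 3) ℂ) = Literature.Geometry.ComplexHyperbolic.BallModel.J),
    (∀ τ' : L →+* ℂ, InfinitePlace.mk τ' ≠ InfinitePlace.mk ι → (H.map τ').PosDef) → 2 ≤ Module.finrank ℚ ↥(maximalRealSubfield L) →
    ∀ {n' : ℕ} (e₁ : Fin 3 × Fin 1 ≃ Fin n') (dV : Fin 3 → L) (hdV : ∀ i, IsCMField.complexConj L (dV i) = dV i)
      (hdV0 : ∀ i, dV i ≠ 0) (g : GL (Fin 3) L)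
      (hg : ((g : Matrix (Fin 3) (Fin 3) L).map (cmConjRingHom L))ᵀ * H * (g : Matrix (Fin 3) (Fin 3) L) = Matrix.diagonal dV)
      (ιV : finAdelic (↥(maximalRealSubfield L)) L (IsCMField.complexConj L) 3 H →*
          finAdelic (↥(maximalRealSubfield L)) L (IsCMField.complexConj L) 3 (Matrix.diagonal dV)),
        (∀ k, ((ιV k : finAdelic (↥(maximalRealSubfield L)) L (IsCMField.complexConj L) 3 (Matrix.diagonal dV)) :
            GL (Fin 3) (FiniteAdeleRing (𝓞 L) L)) =
          (toFinAdeleGL L 3 g)⁻¹ * (k : GL (Fin 3) (FiniteAdeleRing (𝓞 L) L)) * toFinAdeleGL L 3 g) →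
        ∀ (μ : Literature.NumberTheory.Automorphic.IdeleClassGroup L →ₜ* Circle) (hμ : IsConjugateSymplectic L μ), HasWeight L μ 1 →
          ∀ (a : (↥(maximalRealSubfield L))ˣ) (χ : Chi (↥(maximalRealSubfield L)) L (IsCMField.complexConj L)),
            (∃ e : L, IsAdmissibleElement L hμ.cmType.1 e ∧
                epsOf (↥(maximalRealSubfield L)) (imagUnitSq L) L (2 * imagUnit L)⁻¹ e = locF (↥(maximalRealSubfield L)) (imagUnitSq L) a) →
              (InfinitePlace.mk ι).embedding ∈ hμ.cmType.1 →
              ∃ θ : (omegaAtLine (↥(maximalRealSubfield L)) L (IsCMField.complexConj L) 3 e₁ (Matrix.diagonal dV)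
                      (complexConj_imagUnit L) (imagUnit_ne_zero L) (imagUnit_mul_self L) (realDiagonal_isSymm L dV hdV)
                      (isUnit_det_realDiagonal L dV hdV hdV0) (realDiagonal_map L dV hdV).symm
                      (fun a => isCompatible_chiSplittingLine L e₁ dV hdV hdV0 (toHeckeCharacter L μ)
                        (isUnitary_toHeckeCharacter L μ) ((isOscillatorChar_toHeckeCharacter_iff μ).mpr hμ)
                        (TW (↥(maximalRealSubfield L)) a) (isSymm_TW (↥(maximalRealSubfield L)) a)
                        (isUnit_det_TW (↥(maximalRealSubfield L)) a) (JW (↥(maximalRealSubfield L)) L a)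
                        (JW_eq (↥(maximalRealSubfield L)) L a)) a χ) →ₗ[ℂ]
                    ((adelicGroupData (↥(maximalRealSubfield L)) L (IsCMField.complexConj L) 3 H).Adelic → (Fin 2 → ℂ)),
                θ ≠ 0 ∧
                (∀ w, θ w ∈ CotangentForms.cohForms (↥(maximalRealSubfield L)) L (IsCMField.complexConj L) 3 H
                    (cmArchSection L ι H T hT) (cmCompactFactor L ι H T hT)) ∧
                ∀ (k : ↥(finAdelic (↥(maximalRealSubfield L)) L (IsCMField.complexConj L) 3 H)) w,
                  θ (rhoAtLine (↥(maximalRealSubfield L)) L (IsCMField.complexConj L) 3 e₁ (Matrix.diagonal dV)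
                      (complexConj_imagUnit L) (imagUnit_ne_zero L) (imagUnit_mul_self L) (realDiagonal_isSymm L dV hdV)
                      (isUnit_det_realDiagonal L dV hdV hdV0) (realDiagonal_map L dV hdV).symm
                      (fun a => isCompatible_chiSplittingLine L e₁ dV hdV hdV0 (toHeckeCharacter L μ)
                        (isUnitary_toHeckeCharacter L μ) ((isOscillatorChar_toHeckeCharacter_iff μ).mpr hμ)
                        (TW (↥(maximalRealSubfield L)) a) (isSymm_TW (↥(maximalRealSubfield L)) a)
                        (isUnit_det_TW (↥(maximalRealSubfield L)) a) (JW (↥(maximalRealSubfield L)) L a)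
                        (JW_eq (↥(maximalRealSubfield L)) L a)) ιV a χ k w) =
                    fun x => θ w (x * finAdelicToAdelic (↥(maximalRealSubfield L)) L (IsCMField.complexConj L) 3 H k)
 := by
  intro L _ _ _ ι H T hT hHpos h2 n' eV dV hdV hdV0 g hg ιV hιV μ hμ hw a χ hadm hmem
  by_cases hemb : (InfinitePlace.mk ι).embedding = ι
  · exact thetaOccursInGen_caseA L ι H T hT hHpos h2 eV dV hdV hdV0 g hg ιV hιV μ hμ hw a χ hadm hemb (hemb ▸ hmem)
  · exact thetaOccursInGen_caseD L ι H T hT hHpos h2 eV dV hdV hdV0 g hg ιV hιV μ hμ hw a χ hadm hemb hmem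

end Summit.HodgeConjecture.HodgeConjecture.Cruxes.H413.F0P2sThetaOccursInGenOriented

end
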